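import Literature.Geometry.Riemannian.ShrinkerPinchingEigenvalues
import Literature.Geometry.Riemannian.RicciPinchingMinimum
import Literature.Geometry.Riemannian.ThreeShrinkerRicciPinchedCase
import Literature.Geometry.Riemannian.CompactSolitonScalarCurvaturePos
import Literature.Geometry.Lorentzian.CoordOrthonormalEigenframe
import HarnessLib

/-!
# The compact case of `threeShrinkerClassification_modelData`, reduced to the degenerate alternative

Assembly of the compact half of the classification of three-dimensional shrinking gradient Ricci
solitons along Eminenti–La Nave–Mantegazza 2008, §3 (p. 7), over the bricks already in the tree:
for a compact member `(N³, h, φ)` of the binder of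
`Literature.Geometry.Riemannian.threeShrinkerClassification_modelData`,

1. `R > 0` (`ThreeShrinker.scalarCurvature_pos_of_compactSpace`);
2. the minimum `m` of `λ_min(Ric)/R` is attained at a point `p` on a vector `w₀ ≠ 0`
   (`exists_ricci_pinching_minimum`);
3. in the chart at `p`, `w₀` is an eigenvector of `Ric_p` with eigenvalue `mR(p)` (a non-negative
   symmetric form vanishing on `w₀` annihilates `w₀`), which completes to an ordered orthonormal
   eigenframe `(e₀, e₁, e₂)`, `μ₀ = mR(p) ≤ μ₁ ≤ μ₂` (`MetricCoord.exists_orthonormal_eigenframe`);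
4. the point computation `IsMetricOn.eigenvalues_at_pinching_minimum_three` gives
   `(μ₀ = 0 ∧ μ₁ = μ₂) ∨ (μ₀ = μ₁ = μ₂)`;
5. all eigenvalues equal: `m = 1/3`, `Ric ≥ (R/3)h` everywhere, and the conclusion of the fact holds
   (`ThreeShrinker.modelData_of_ricci_ge_third`: trace step, Schur, Einstein ⇒ round space form);
6. `μ₀ = 0`: `m = 0`, i.e. `Ric ≥ 0` on `N` with a null vector at `p`.

Hence **`ThreeShrinker.modelData_or_ricci_degenerate_of_compactSpace`**: the conclusion of the fact,
OR `Ric ≥ 0` everywhere with `Ric_p(w₀,w₀) = 0` for some `w₀ ≠ 0`. Excluding the second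
alternative is the second half of the printed proof (a smooth local eigenvector field for the
simple eigenvalue `λ_min`, an elliptic inequality for `λ_min`, E. Hopf's strong minimum principle,
and the contradiction `∇²f(v,v) = ½ > 0` at a maximum point of `f`), equivalently Hamilton's strong
maximum principle for `Ric ≥ 0`; it is not carried out here.

Everything is proved; no definitions are introduced.

## References

* M. Eminenti, G. La Nave, C. Mantegazza, *Ricci solitons: the equation point of view*,
  manuscripta math. 127 (2008), §3 (p. 7), Prop. 3.7. [EminentiLanaveMantegazza2008]
* T. Ivey, *Ricci solitons on compact three-manifolds*, Diff. Geom. Appl. 3 (1993). [Ivey1993]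
* O. Munteanu, J. Wang, arXiv:1606.01861, Thm. 1.2 (p. 3). [MunteanuWang2016]
-/

noncomputable section

set_option maxSynthPendingDepth 3

open Bundle Set Function Filter Module MeasureTheory Metric
open scoped Manifold ContDiff Topology ENNReal NNReal

namespace Literature.Geometry.Riemannian

open Lorentzian Lorentzian.PseudoRiemannianMetric

/-! ### A non-negative symmetric form vanishing on a vector annihilates it -/

/-- For a symmetric `B ≥ 0` with `B(e,e) = 0`: `B(e, ·) = 0` (the quadratic polynomial
`t ↦ B(e + tw, e + tw) ≥ 0` has no linear term). [folklore] -/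
theorem clm_apply_eq_zero_of_nonneg_of_apply_self_eq_zero {E : Type*} [NormedAddCommGroup E]
    [NormedSpace ℝ E] {B : E →L[ℝ] E →L[ℝ] ℝ} (hsymm : ∀ v w, B v w = B w v)
    (hB : ∀ v, 0 ≤ B v v) {e : E} (he : B e e = 0) (w : E) : B e w = 0 := by
  by_contra hc
  set c := B e w with hcdef
  set a := B w w with hadef
  have ha : 0 ≤ a := hB w
  have hexp : ∀ t : ℝ, 0 ≤ 2 * t * c + t ^ 2 * a := fun t ↦ by
    have h := hB (e + t • w)
    have : B (e + t • w) (e + t • w) = B e e + 2 * t * B e w + t ^ 2 * B w w := by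
      simp only [map_add, map_smul, _root_.add_apply, _root_.smul_apply, smul_eq_mul, hsymm w e]
      ring
    rw [this, he] at h
    linarith
  have h1 := hexp (-c / (a + 1))
  have ha1 : 0 < a + 1 := by linarith
  have hkey : 2 * (-c / (a + 1)) * c + (-c / (a + 1)) ^ 2 * a = -(c ^ 2 * (a + 2)) / (a + 1) ^ 2 := by
    field_simp
    ring
  rw [hkey] at h1
  have hnum : 0 < c ^ 2 * (a + 2) := by positivity
  have : -(c ^ 2 * (a + 2)) / (a + 1) ^ 2 < 0 := div_neg_of_neg_of_pos (by linarith) (by positivity)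
  linarith

/-! ### Reading `Ric`, `h` in the chart -/

section Chart

variable {E : Type*} [NormedAddCommGroup E] [NormedSpace ℝ E] [FiniteDimensional ℝ E]
  {H : Type*} [TopologicalSpace H] {I : ModelWithCorners ℝ E H} [I.Boundaryless]
  {M : Type*} [TopologicalSpace M] [ChartedSpace H M] [IsManifold I ∞ M]
  (g : PseudoRiemannianMetric I ∞ E (TangentSpace I : M → Type _)) [g.HasLeviCivita]

/-- `Ric_{Φu}(dΦ v, dΦ w) = ricAt G u (v, w)` for the chart components `G`.
[cite: ONeill1983, Ch. 3, Prop. 3.59] -/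
theorem ricci_chartInv_mfderiv_eq_ricAt (x₀ : M) (u : chartTarget I x₀) (v w : E) :
    g.ricci (chartInv I x₀ u) (mfderiv 𝓘(ℝ, E) I (chartInv I x₀) u v)
        (mfderiv 𝓘(ℝ, E) I (chartInv I x₀) u w) =
      MetricCoord.ricAt (chartRep I (fun _ ↦ g) x₀ 0) u v w := by
  haveI := (chartPullback I g x₀).hasLeviCivita
  have hG := val_chartPullback_eq_chartRep (fun _ : ℝ ↦ g) x₀ 0
  rw [← Lorentzian.OpensChart.ricci_eq_ricAt hG u,
    g.ricci_comap_apply contMDiff_pullbackBilin_holds (contMDiff_chartInv x₀)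
      (injective_mfderiv_chartInv x₀) rfl u]

omit [g.HasLeviCivita] in
/-- `h_{Φu}(dΦ v, dΦ w) = G u (v, w)`. [cite: ONeill1983, Ch. 3, Prop. 3.59] -/
theorem val_chartInv_mfderiv_eq_chartRep (x₀ : M) (u : chartTarget I x₀) (v w : E) :
    g.val (chartInv I x₀ u) (mfderiv 𝓘(ℝ, E) I (chartInv I x₀) u v)
        (mfderiv 𝓘(ℝ, E) I (chartInv I x₀) u w) = chartRep I (fun _ ↦ g) x₀ 0 u v w := by
  rw [chartRep_apply, val_chartPullback_apply]

end Chart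

/-! ### Reindexing an eigenframe of `Fin 3` -/

/-- Given `j : Fin 3` and weights `μ`, a permutation `σ` of `Fin 3` with `σ 0 = j` and
`μ (σ 1) ≤ μ (σ 2)`. [folklore] -/
theorem exists_perm_fin_three (j : Fin 3) (μ : Fin 3 → ℝ) :
    ∃ σ : Equiv.Perm (Fin 3), σ 0 = j ∧ μ (σ 1) ≤ μ (σ 2) := by
  set σ₁ : Equiv.Perm (Fin 3) := Equiv.swap 0 j with hσ₁
  have h0 : σ₁ 0 = j := by rw [hσ₁, Equiv.swap_apply_left]
  by_cases hle : μ (σ₁ 1) ≤ μ (σ₁ 2)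
  · exact ⟨σ₁, h0, hle⟩
  · refine ⟨σ₁ * Equiv.swap (1 : Fin 3) 2, ?_, ?_⟩
    · rw [Equiv.Perm.mul_apply, show (Equiv.swap (1 : Fin 3) 2) 0 = 0 from by decide, h0]
    · rw [Equiv.Perm.mul_apply, Equiv.Perm.mul_apply,
        show (Equiv.swap (1 : Fin 3) 2) 1 = 2 from by decide,
        show (Equiv.swap (1 : Fin 3) 2) 2 = 1 from by decide]
      exact (lt_of_not_ge hle).le

/-! ### The reduction -/

namespace ThreeShrinker

/-- **The compact case of `threeShrinkerClassification_modelData`, reduced to the degenerate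
alternative** (Eminenti–La Nave–Mantegazza 2008, §3: the minimum-point analysis of `λ_min(Ric)/R`
and its first case, assembled; see the module docstring): for a compact member of the binder of the
fact, EITHER its conclusion holds, OR `Ric ≥ 0` on `N` with `Ric_p(w₀,w₀) = 0` for some point `p`
and some `w₀ ≠ 0` (the case `λ_min(p) = 0` of the printed proof, excluded there by the strong
maximum principle). [cite: EminentiLanaveMantegazza2008, §3 (p. 7), Prop. 3.7]
[cite: MunteanuWang2016, Thm 1.2 (p. 3)] [cite: Ivey1993] -/
theorem modelData_or_ricci_degenerate_of_compactSpace (N : Type*) [TopologicalSpace N] [T2Space N]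
    [ChartedSpace (EuclideanSpace ℝ (Fin 3)) N] [IsManifold (𝓡 3) ∞ N] [CompactSpace N]
    [ConnectedSpace N] [MeasurableSpace N] [BorelSpace N] [T3Space N]
    (h : PseudoRiemannianMetric (𝓡 3) ∞ (EuclideanSpace ℝ (Fin 3))
      (TangentSpace (𝓡 3) : N → Type _)) [h.HasLeviCivita] (hh : h.IsRiemannian)
    (φ : N → ℝ) (hφ : ContMDiff (𝓡 3) 𝓘(ℝ, ℝ) ∞ φ)
    (hsol : ∀ (x : N) (X Y : TangentSpace (𝓡 3) x),
      h.ricci x X Y + h.hessian φ x X Y = (1 / 2 : ℝ) * h.val x X Y)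
    (hnorm : ∀ x : N, h.scalarCurvature x + h.gradSq φ x = φ x) :
    (((∀ x : N, h.scalarCurvature x = 0) ∧
        ∫⁻ x, ENNReal.ofReal (Real.exp (-φ x))
            ∂(riemannianMeasure (h.toContMDiffRiemannianMetric hh)) =
          ENNReal.ofReal (8 * Real.pi * Real.sqrt Real.pi)) ∨
      (CompactSpace N ∧ (∀ x : N, h.scalarCurvature x = 3 / 2) ∧ (∀ x : N, φ x = 3 / 2) ∧
        ∃ k : ℕ, 0 < k ∧
          riemannianMeasure (h.toContMDiffRiemannianMetric hh) Set.univ =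
            ENNReal.ofReal (16 * Real.pi ^ 2 / k)) ∨
      ((∀ x : N, h.scalarCurvature x = 1) ∧
        ∫⁻ x, ENNReal.ofReal (Real.exp (-φ x))
            ∂(riemannianMeasure (h.toContMDiffRiemannianMetric hh)) =
          ENNReal.ofReal (16 * Real.pi * Real.sqrt Real.pi * Real.exp (-1))) ∨
      ((∀ x : N, h.scalarCurvature x = 1) ∧
        ∫⁻ x, ENNReal.ofReal (Real.exp (-φ x))
            ∂(riemannianMeasure (h.toContMDiffRiemannianMetric hh)) =
          ENNReal.ofReal (8 * Real.pi * Real.sqrt Real.pi * Real.exp (-1)))) ∨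
    ((∀ (x : N) (w : TangentSpace (𝓡 3) x), 0 ≤ h.ricci x w w) ∧
      ∃ (p : N) (w₀ : TangentSpace (𝓡 3) p), w₀ ≠ 0 ∧ h.ricci p w₀ w₀ = 0) := by
  classical
  -- (1) `R > 0`
  have hS : ∀ x, 0 < h.scalarCurvature x := scalarCurvature_pos_of_compactSpace N h φ hh hφ hsol
  -- (2) the pinching minimum
  have h3 : finrank ℝ (EuclideanSpace ℝ (Fin 3)) = 3 := finrank_euclideanSpace_fin
  obtain ⟨p, m, hpinch, w₀, hw₀, heqp⟩ :=
    exists_ricci_pinching_minimum h hh hS (by rw [h3]; norm_num)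
  -- (3) the chart at `p`
  set G := chartRep (𝓡 3) (fun _ ↦ h) p 0 with hGdef
  set T : Set (EuclideanSpace ℝ (Fin 3)) := (extChartAt (𝓡 3) p).target with hT
  have hGm : MetricCoord.IsMetricOn G T :=
    Lorentzian.OpensChart.isMetricOn_repr (val_chartPullback_eq_chartRep (fun _ : ℝ ↦ h) p 0)
  have hGpos : ∀ y ∈ T, ∀ v : EuclideanSpace ℝ (Fin 3), v ≠ 0 → 0 < G y v v := by
    intro y hy v hv
    rw [hGdef, show y = ((⟨y, hy⟩ : chartTarget (𝓡 3) p) : EuclideanSpace ℝ (Fin 3)) from rfl,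
      chartRep_apply]
    exact chartPullback_pos h p ⟨y, hy⟩ (fun w hw ↦ hh _ w hw) v hv
  have hu₀ : extChartAt (𝓡 3) p p ∈ T := mem_extChartAt_target p
  set u₀ : chartTarget (𝓡 3) p := ⟨extChartAt (𝓡 3) p p, hu₀⟩ with hu₀def
  have hΦu₀ : chartInv (𝓡 3) p u₀ = p := extChartAt_to_inv p
  set fc : EuclideanSpace ℝ (Fin 3) → ℝ := φ ∘ (extChartAt (𝓡 3) p).symm with hfc
  have hfcs : ContDiffOn ℝ ∞ fc T := by
    rw [hfc, ← contMDiffOn_iff_contDiffOn]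
    exact hφ.comp_contMDiffOn (contMDiffOn_extChartAt_symm p)
  have hsolc := soliton_chartRep_target h p hφ hsol
  have hScal : ∀ y (hy : y ∈ T), MetricCoord.scalAt G y = h.scalarCurvature (chartInv (𝓡 3) p ⟨y, hy⟩) :=
    fun y hy ↦ (Lorentzian.scalarCurvature_chartInv_eq h p ⟨y, hy⟩).symm
  have hSpos : ∀ y ∈ T, 0 < MetricCoord.scalAt G y := fun y hy ↦ by rw [hScal y hy]; exact hS _
  -- the pinching read in the chart
  have hminc : ∀ y ∈ T, ∀ w : EuclideanSpace ℝ (Fin 3),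
      m * MetricCoord.scalAt G y * G y w w ≤ MetricCoord.ricAt G y w w := by
    intro y hy w
    have hp' := hpinch (chartInv (𝓡 3) p ⟨y, hy⟩) (mfderiv 𝓘(ℝ, EuclideanSpace ℝ (Fin 3)) (𝓡 3)
      (chartInv (𝓡 3) p) ⟨y, hy⟩ w)
    rw [ricci_chartInv_mfderiv_eq_ricAt, val_chartInv_mfderiv_eq_chartRep, ← hScal y hy] at hp'
    exact hp'
  -- (3') `w₀` read in the chart is an eigenvector of eigenvalue `μ* = m R(p)`
  set L := mfderiv 𝓘(ℝ, EuclideanSpace ℝ (Fin 3)) (𝓡 3) (chartInv (𝓡 3) p) u₀ with hL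
  have hinj : Function.Injective L := injective_mfderiv_chartInv (I := 𝓡 3) p u₀
  have hinv := isInvertible_mfderiv_of_injective rfl hinj
  -- transport the equality at `p` to `Φ u₀`
  have heqp' : ∀ w : TangentSpace (𝓡 3) (chartInv (𝓡 3) p u₀), w ≠ 0 →
      (∃ w' : TangentSpace (𝓡 3) (chartInv (𝓡 3) p u₀), w' ≠ 0 ∧
        h.ricci (chartInv (𝓡 3) p u₀) w' w' =
          m * h.scalarCurvature (chartInv (𝓡 3) p u₀) * h.val (chartInv (𝓡 3) p u₀) w' w') := by
    intro _ _
    rw [hΦu₀]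
    exact ⟨w₀, hw₀, heqp⟩
  obtain ⟨w₁, hw₁, heq₁⟩ := heqp' w₀ hw₀
  obtain ⟨v₀, rfl⟩ : ∃ v : EuclideanSpace ℝ (Fin 3), L v = w₁ :=
    ⟨L.inverse w₁, by rw [← ContinuousLinearMap.comp_apply, hinv.self_comp_inverse]; rfl⟩
  have hv₀ : v₀ ≠ 0 := fun h0 ↦ hw₁ (by subst h0; exact map_zero L)
  rw [hL, ricci_chartInv_mfderiv_eq_ricAt, val_chartInv_mfderiv_eq_chartRep, ← hScal _ hu₀] at heq₁
  -- `heq₁ : ricAt G u₀ v₀ v₀ = m * scalAt G u₀ * G u₀ v₀ v₀`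
  set μs : ℝ := m * MetricCoord.scalAt G u₀ with hμs
  have hi := hGm.isInvertible _ hu₀
  have hs := hGm.symm _ hu₀
  have heigen : ∀ w, MetricCoord.ricAt G u₀ v₀ w = μs * G u₀ v₀ w := by
    intro w
    set B : EuclideanSpace ℝ (Fin 3) →L[ℝ] EuclideanSpace ℝ (Fin 3) →L[ℝ] ℝ :=
      MetricCoord.ricAt G u₀ - μs • G u₀ with hB
    have hBapp : ∀ v w, B v w = MetricCoord.ricAt G u₀ v w - μs * G u₀ v w := fun v w ↦ by
      simp only [hB, _root_.sub_apply, _root_.smul_apply, smul_eq_mul]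
    have hBs : ∀ v w, B v w = B w v := fun v w ↦ by
      rw [hBapp, hBapp, hGm.ricAt_comm hu₀ v w, hs v w]
    have hBnn : ∀ v, 0 ≤ B v v := fun v ↦ by
      rw [hBapp]
      have := hminc _ hu₀ v
      rw [hμs]
      linarith
    have hBe : B v₀ v₀ = 0 := by rw [hBapp, heq₁, hμs]; ring
    have h0 := clm_apply_eq_zero_of_nonneg_of_apply_self_eq_zero hBs hBnn hBe w
    rw [hBapp] at h0
    linarith
  -- (4) an ordered orthonormal eigenframe with `e 0`-eigenvalue `μ*`
  obtain ⟨e'', μ'', he'', hμ''⟩ := MetricCoord.exists_orthonormal_eigenframe hs (hGpos _ hu₀)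
    (MetricCoord.ricAt G u₀) (fun v w ↦ hGm.ricAt_comm hu₀ v w)
  set e' : Basis (Fin 3) ℝ (EuclideanSpace ℝ (Fin 3)) := e''.reindex (finCongr h3) with he'def
  set μ' : Fin 3 → ℝ := μ'' ∘ (finCongr h3).symm with hμ'def
  have he' : ∀ i j, G u₀ (e' i) (e' j) = if i = j then 1 else 0 := fun i j ↦ by
    rw [he'def, Basis.reindex_apply, Basis.reindex_apply, he'']
    simp only [finCongr_symm, finCongr_apply, Fin.cast_inj]
  have hμ' : ∀ i w, MetricCoord.ricAt G u₀ (e' i) w = μ' i * G u₀ (e' i) w := fun i w ↦ by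
    rw [he'def, Basis.reindex_apply, hμ'', hμ'def, Function.comp_apply]
  -- the coefficients of `v₀` and an index `j` with `μ' j = μ*`
  have hcoef : ∀ i, (μ' i - μs) * G u₀ v₀ (e' i) = 0 := fun i ↦ by
    have h1 := heigen (e' i)
    have h2 : MetricCoord.ricAt G u₀ v₀ (e' i) = μ' i * G u₀ v₀ (e' i) := by
      rw [hGm.ricAt_comm hu₀ v₀ (e' i), hμ', hs]
    linarith
  have hj : ∃ j, μ' j = μs := by
    by_contra hne
    push Not at hne
    have hc0 : ∀ i, G u₀ v₀ (e' i) = 0 := fun i ↦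
      (mul_eq_zero.mp (hcoef i)).resolve_left (sub_ne_zero.mpr (hne i))
    apply hv₀
    rw [← MetricCoord.sum_apply_smul_of_orthonormal e' he' v₀]
    simp [hc0]
  obtain ⟨j, hjμ⟩ := hj
  obtain ⟨σ, hσ0, hσle⟩ := exists_perm_fin_three j μ'
  set e : Basis (Fin 3) ℝ (EuclideanSpace ℝ (Fin 3)) := e'.reindex σ.symm with hedef
  set μ : Fin 3 → ℝ := μ' ∘ σ with hμdef
  have heσ : ∀ i, e i = e' (σ i) := fun i ↦ by rw [hedef, Basis.reindex_apply, Equiv.symm_symm]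
  have he : ∀ i k, G u₀ (e i) (e k) = if i = k then 1 else 0 := fun i k ↦ by
    rw [heσ, heσ, he']
    simp only [EmbeddingLike.apply_eq_iff_eq]
  have hμ : ∀ i w, MetricCoord.ricAt G u₀ (e i) w = μ i * G u₀ (e i) w := fun i w ↦ by
    rw [heσ, hμ', hμdef, Function.comp_apply]
  have hμ0 : μ 0 = μs := by rw [hμdef, Function.comp_apply, hσ0, hjμ]
  have hdiag : ∀ i, MetricCoord.ricAt G u₀ (e i) (e i) = μ i := fun i ↦ by rw [hμ, he]; simp
  have hord₁ : μ 0 ≤ μ 1 := by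
    have h1 := hminc _ hu₀ (e 1)
    rw [hdiag 1, he 1 1, if_pos rfl, mul_one] at h1
    rw [hμ0, hμs]
    exact h1
  have hord₂ : μ 1 ≤ μ 2 := hσle
  have heq0 : MetricCoord.ricAt G u₀ (e 0) (e 0) =
      m * MetricCoord.scalAt G u₀ * G u₀ (e 0) (e 0) := by
    rw [hdiag, hμ0, he, hμs]; simp
  -- (5) the point computation
  have hcases := hGm.eigenvalues_at_pinching_minimum_three hu₀ (hGpos _ hu₀) hfcs hsolc e he hμ
    hminc heq0 hord₁ hord₂ (hSpos _ hu₀)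
  have hSsum : MetricCoord.scalAt G u₀ = μ 0 + μ 1 + μ 2 := by
    rw [MetricCoord.scalAt_eq_sum_of_eigenframe e he hμ hi, Fin.sum_univ_three]
  rcases hcases with ⟨hz, -⟩ | ⟨h01, h12⟩
  · -- (6) `μ₀ = 0`: `m = 0`, `Ric ≥ 0` with the null vector `w₀`
    right
    have hm : m = 0 := by
      have hμs0 : μs = 0 := by rw [← hμ0, hz]
      rw [hμs] at hμs0
      exact (mul_eq_zero.mp hμs0).resolve_right (hSpos _ hu₀).ne'
    refine ⟨fun x w ↦ ?_, p, w₀, hw₀, ?_⟩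
    · have := hpinch x w
      rw [hm] at this
      simpa using this
    · rw [heqp, hm]; simp
  · -- all equal: `m = 1/3`, `Ric ≥ (R/3) h`
    left
    have hm : m = 1 / 3 := by
      have hS3 : MetricCoord.scalAt G u₀ = 3 * μs := by rw [hSsum, ← h01, ← h12, ← h01, hμ0]; ring
      rw [hμs] at hS3
      have hSne := (hSpos _ hu₀).ne'
      have h1 : MetricCoord.scalAt G u₀ * 1 = MetricCoord.scalAt G u₀ * (3 * m) := by
        linarith [hS3]
      have h2 := mul_left_cancel₀ hSne h1
      linarith
    refine modelData_of_ricci_ge_third N h hh φ hφ hsol hnorm fun x w ↦ ?_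
    have := hpinch x w
    rw [hm] at this
    linarith

end ThreeShrinker

end Literature.Geometry.Riemannian

end
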